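import Literature.AlgebraicGeometry.Motives.SupersingularLefschetzOfDeuring
import Literature.AlgebraicGeometry.Motives.AlgPointsSeparate
import Literature.AlgebraicGeometry.Motives.AbelianVarietyDimZeroProofs
import Mathlib.Algebra.CharP.Algebra
import HarnessLib

/-!
# Lenstra–Zarhin for supersingular abelian varieties: the characteristic-zero case

The named fact `LenstraZarhin1993_supersingular_lefschetzClasses_eq_top`
(`Motives/SupersingularAbelianVariety`; Lenstra–Zarhin 1993, §1, p. 179) quantifies over all
fields `k`; supersingularity (`AbelianVariety.IsSupersingular`, Li–Oort, LNM 1680, §0.1) is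
phrased through supersingular elliptic curves `E/k̄`, `E[p](k̄) = 0` with `p = char k`
(`AbelianVariety.IsSupersingularEllipticCurve`). In characteristic `0` the condition reads
`E(k̄) = 0`, which no positive-dimensional abelian variety satisfies: a non-zero homomorphism of
abelian varieties moves some geometric point (`AbelianVariety.exists_geomPointsMap_ne_zero`,
Mumford §4: `A ↦ A(K̄)` is faithful), and `𝟙 E ≠ 0` for `dim E > 0`. Hence over a field of
characteristic `0` only zero-dimensional abelian varieties are supersingular and **the named fact
holds unconditionally in characteristic zero**
(`LenstraZarhin1993_supersingular_lefschetzClasses_eq_top_of_charZero`), through the tree's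
assembly `…_of_deuring`, whose hypothesis is then vacuous.

Everything is a theorem; no definitions, no named facts.

## References

* [LenstraZarhin1993] H. W. Lenstra, Jr., Yu. G. Zarhin, *The Tate conjecture for almost ordinary
  abelian varieties over finite fields*, Advances in Number Theory (1993), §1, p. 179.
* [LiOort1998] K.-Z. Li, F. Oort, *Moduli of Supersingular Abelian Varieties*, LNM 1680, §0.1.
* [MumfordAV1970] D. Mumford, *Abelian Varieties* (1970), §4.
-/

noncomputable section

universe u v

open CategoryTheory AlgebraicGeometry

namespace Literature.AlgebraicGeometry.Motives

namespace AbelianVariety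

variable {K : Type u} [Field K]

/-- **A positive-dimensional abelian variety has a non-trivial geometric point**: `𝟙 A ≠ 0`
(the zero map is not an isogeny onto a positive-dimensional `A`, `not_isIsogeny_zero_of_dim_pos`),
and a non-zero homomorphism moves some `K̄`-point (`exists_geomPointsMap_ne_zero`, Mumford §4).
[cite: MumfordAV1970, §4] -/
theorem nontrivial_points_algebraicClosure (A : AbelianVariety K) (hA : 0 < A.dim) :
    Nontrivial (A.Points (AlgebraicClosure K)) := by
  have h1 : (𝟙 A : A ⟶ A) ≠ 0 := fun h ↦
    not_isIsogeny_zero_of_dim_pos (X := A) hA (h ▸ isIsogeny_id A)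
  obtain ⟨P, hP⟩ := exists_geomPointsMap_ne_zero h1
  rw [Hom.geomPointsMap_id, AddMonoidHom.id_apply] at hP
  refine ⟨⟨Additive.toMul P, 1, fun h ↦ hP ?_⟩⟩
  rw [← ofMul_toMul P, h]
  rfl

/-- Every point is `0`-torsion: `A[0](L) = A(L)` (`P ^ 0 = 1`). [folklore] -/
theorem torsionPoints_zero (A : AbelianVariety K) (L : Type u) [Field L] [Algebra K L] :
    A.torsionPoints L 0 = ⊤ := by
  ext P
  simp [mem_torsionPoints_iff]

/-- **In characteristic `0` there is no supersingular elliptic curve** in the sense of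
`IsSupersingularEllipticCurve` (`E[p](k̄) = 0` with `p = char K = 0` would mean `E(k̄) = 0`,
impossible for `dim E = 1` by `nontrivial_points_algebraicClosure`; Li–Oort, §0.1, define
supersingularity in positive characteristic only). [cite: LiOort1998, §0.1 and §1.1] -/
theorem not_isSupersingularEllipticCurve_of_ringChar_eq_zero (E : AbelianVariety K)
    (hK : ringChar K = 0) : ¬ E.IsSupersingularEllipticCurve := by
  rintro ⟨h1, htors⟩
  rw [hK, Nat.cast_zero, torsionPoints_zero] at htors
  haveI := E.nontrivial_points_algebraicClosure (by omega)
  exact top_ne_bot htors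

/-- In characteristic `0` only zero-dimensional abelian varieties are supersingular.
[cite: LiOort1998, §0.1 and §1.1] -/
theorem dim_eq_zero_of_isSupersingular_of_ringChar_eq_zero (A : AbelianVariety K)
    (hK : ringChar K = 0) (hA : A.IsSupersingular) : A.dim = 0 := by
  rcases hdim : A.dim with _ | g
  · rfl
  obtain ⟨E, hE, -⟩ := (isSupersingular_iff_of_dim_eq_succ hdim).1 hA
  exact absurd hE (E.not_isSupersingularEllipticCurve_of_ringChar_eq_zero
    ((Algebra.ringChar_eq K (AlgebraicClosure K)).symm.trans hK))

end AbelianVariety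

/-! ## The named fact in characteristic zero -/

variable {k : Type u} [Field k] {K : Type v} [Field K] [CharZero K] (W : WeilCohomology k K)

/-- **Lenstra–Zarhin's statement holds over fields of characteristic `0`** (where it is
vacuous in positive dimension): for `char k = 0` no elliptic curve over `k̄` is supersingular
(`not_isSupersingularEllipticCurve_of_ringChar_eq_zero`), so the hypothesis of
`LenstraZarhin1993_supersingular_lefschetzClasses_eq_top_of_deuring` is vacuous, and the
zero-dimensional case is `…_of_dim_eq_zero`. [cite: LenstraZarhin1993, §1 p. 179] -/
theorem LenstraZarhin1993_supersingular_lefschetzClasses_eq_top_of_ringChar_eq_zero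
    (A : AbelianVariety k) (hk : ringChar k = 0) :
    LenstraZarhin1993_supersingular_lefschetzClasses_eq_top W A :=
  LenstraZarhin1993_supersingular_lefschetzClasses_eq_top_of_deuring W A fun E hE ↦
    absurd hE (E.not_isSupersingularEllipticCurve_of_ringChar_eq_zero
      ((Algebra.ringChar_eq k (AlgebraicClosure k)).symm.trans hk))

/-- **Lenstra–Zarhin's statement holds over fields of characteristic `0`**, `CharZero` form.
[cite: LenstraZarhin1993, §1 p. 179] -/
theorem LenstraZarhin1993_supersingular_lefschetzClasses_eq_top_of_charZero [CharZero k]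
    (A : AbelianVariety k) : LenstraZarhin1993_supersingular_lefschetzClasses_eq_top W A :=
  LenstraZarhin1993_supersingular_lefschetzClasses_eq_top_of_ringChar_eq_zero W A
    (ringChar.eq_zero)

end Literature.AlgebraicGeometry.Motives

end
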